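import Literature.MathematicalPhysics.QuantumFieldTheory.Balaban1983to89.StepInhabited
import Literature.MathematicalPhysics.QuantumFieldTheory.Balaban1983to89.B12RTGaugeInvariance254

/-!
# `Balaban1983to89.B12Eq019ActionBody` — T. Bałaban, *Renormalization group approach to lattice gauge field theories. I*,
Commun. Math. Phys. **109** (1987) 249–301 [Balaban1987RG1], (0.17)/(0.19) pp. 255–256: **the small-field effective actions
`A_{k+1} = 𝐓_k A_k` WITH BODY** — `A_{k+1}(V) := log 𝐍_k⁻¹ (T_k(χ_k e^{−GF/g_k² + A_k}))(V)`, `𝐍_k :=` the same at `V = 1`, and the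
inductively defined sequence `A_0, A_1, …, A_K` — over the cell's renormalization-transformation OPERATOR (0.13); the cell's
predicate `Setup.SmallFieldStepOp` is CHARACTERISED by the body (it holds iff the transformed density is positive, and then its
`A_{k+1}` IS this body: the definition is forced).

HONEST FRAMING (cell `lit-balaban`, verbatim): statement-level skeleton of published theorems with citation tags; proofs where landed; nothing here is a claim about the Yang–Mills mass gap.

PDF held: `paper:balaban1987-cmp109-rg-i-small-field` (journal page = PDF page + 248); pp. 255–256 = PDF 7–8 re-read by this unit on
the renders `b2b-balaban-ref1/pages/1987-cmp109-rg-I-small-field/…-p007-x2.png`, `…-p008-x2.png` (2026-08-23).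

THE PRINT, verbatim.  p. 255: *«We now define the renormalization transformations. According to our point of view, connected with
small field restrictions, they map actions into actions. In the first step we define
A₁(V) = (𝐓₀A)(V) = log 𝐍₀⁻¹ ∫dU Π_{c∈T⁽¹⁾} δ(Ū(c)V⁻¹(c)) × χ₀ exp[−(1/g₀²) Σ_{y∈T⁽¹⁾} Σ_{x∈B(y),x≠y} [1 − Re tr U(y,x)] − (1/g₀²) A(U)], (0.17)
where the normalization factor 𝐍₀ is given by the same integral as above, but with V = 1. […] The k-th action A_k determines a
coupling constant g_k. The (k+1)-st action A_{k+1} is defined by the generalization of (0.17),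
A_{k+1}(g_{k+1}, V) = (𝐓_kA_k)(g_{k+1}, V) = log 𝐍_k⁻¹ ∫dU Π_{c∈T⁽ᵏ⁺¹⁾} δ(Ū(c)V⁻¹(c)) × χ_k exp[−(1/g_k²) Σ_{y∈T⁽ᵏ⁺¹⁾} Σ_{x∈B(y),x≠y}
[1 − Re tr U(y,x)] + A_k(g_k, U)], (0.19)»*; p. 256: *«where the constant 𝐍_k is given by the integral above with V = 1, and the
coupling constant g_{k+1} is determined from the equation 1/g_k² = 1/g_{k+1}² + β_{k+1}(g_k). (0.20) […] We continue the calculation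
of the effective actions until we reach the unit lattice […]. Let us denote the corresponding index by K, hence ε = L⁻ᴷ, and the
sequence of actions and coupling constants is defined for k = 0, 1, …, K.»*; p. 264 (Theorem 3): *«the sequence of actions A_k,
defined inductively by the small field renormalization transformations T_k with the restrictions given by ε₀, ε₁».*  Inside
quotation marks `[…]` marks an omission by the author of this file.

WHY THIS FILE.  The cell's carrier of record for (0.17)/(0.19) is the PREDICATE `Setup.SmallFieldStepOp T χ GF g_k A_k A_{k+1}`
(`∃ N > 0, T(χ·e^{−GF/g_k² + A_k}) = N·e^{A_{k+1}} ∧ A_{k+1}(1) = 0`; `SmallFieldStep`/`SmallFieldStepI` are it at `T.T`, `rfl`),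
and every tower record (`Step.GeneratedBySmallFieldRT.step`, `Step.GeneratedBySteps.step` of module `StepInhabited`) takes the whole sequence
`A : ∀ k, Density P k G` as a DATUM related by that predicate.  Print, however, DEFINES `A_{k+1}` outright — it is the logarithm of
the normalised transformed density — and defines the sequence by induction from the Wilson action.  The display owner's reading
rule for definition displays (lead g11, HOME/STATUS 2026-08-23T07:00:05Z, (a): «the definiens exists as a declaration WITH BODY»)
therefore asks for exactly this object at rows B12.Eq0.17 / B12.Eq0.19 (r09, `typed-existing`) and, through them, at the fold
owner's coarse row B12.Def§0 (r20).  In the cell's push-forward reading of (0.13) (DIVERGENCE F7 of `pub-balaban`: the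
`δ`-function integral `∫dU Π_c δ(Ū(c)V⁻¹(c)) (…)` IS the operator `T` applied to the density `(…)`), the new content of
(0.17)/(0.19) over (0.13) is precisely the `log`/normalisation layer — which is what this module defines, and nothing else.

DICTIONARY print → Lean (cell vocabulary `Setup`: `Density P k G = GaugeField P k G → ℝ`, the trivial configuration
`1 : GaugeField P k G` (print's `V = 1`), the gauge-fixing term `GF` (= `Setup.gaugeFixFn cd Y`, print's double sum
`Σ_y Σ_{x∈B(y),x≠y}[1 − Re tr U(y,x)]`, kept abstract as in `SmallFieldStepOp`), the small-field characteristic function `χ_k`,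
the Wilson action `Setup.wilsonAction w` (print's `A(U)`, (0.2), weight `w = ε^{d−4}`), an RT operator
`T : Density P k G → Density P (k+1) G` ((0.13); `RTOp.T`/`RTOpI.T`/`B12FaddeevPopov016.KernelRT.T`)).
* `χ_k exp[−(1/g_k²) GF(U) + A_k(g_k,U)]` ↦ `integrand χ GF g A` (`rfl` = the lambda inside `Setup.SmallFieldStepOp`);
* «𝐍_k is given by the integral above with V = 1» ↦ `normConst T χ GF g A := T (integrand χ GF g A) 1`;
* (0.19) `A_{k+1}(g_{k+1}, V) = log 𝐍_k⁻¹ ∫…` ↦ `nextAction T χ GF g A V := Real.log ((normConst T χ GF g A)⁻¹ * T (integrand χ GF g A) V)`;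
* (0.17) `A₁ = 𝐓₀A` with the exponent `… − (1/g₀²)A(U)` ↦ `firstAction T χ GF g₀ w := nextAction T χ GF g₀ (wilsonTerm g₀ w)`,
  `wilsonTerm g₀ w U := −(1/g₀²)·wilsonAction w U` (the action `A_0`);
* «the sequence of actions … is defined for k = 0, 1, …, K» ↦ `actionSeq Tk χ GF g A₀ : ∀ k, Density P k G` (structural recursion;
  `g : ℕ → ℝ` the coupling sequence of (0.18)/(0.20), a PARAMETER here — its determination from the actions through the
  β-functions is rows B12.Eq0.18/0.20/1.22, not this file).

WHAT IS DEFINED AND PROVED (defs with bodies + theorems; no `Prop` placeholder, no new fact, no sorry; axioms standard).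
§1 the body: `integrand`, `normConst`, `nextAction` (+ `_def`/`_apply` unfolding lemmas); **`nextAction_one`** — `A_{k+1}(1) = 0`
   UNCONDITIONALLY (the clause the cell carries inside `SmallFieldStepOp` is a theorem of the body);
   **`exp_nextAction`** — under positivity of the transformed density, `𝐍_k · e^{A_{k+1}(V)} = (T(χ_k e^{…}))(V)`.
§2 the cell's predicate characterised: **`smallFieldStepOp_nextAction`** (positivity ⇒ `SmallFieldStepOp T χ GF g A (nextAction …)`,
   witness `N = normConst`); **`eq_nextAction_of_smallFieldStepOp`** (THE DEFINITION IS FORCED: every `A'` with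
   `SmallFieldStepOp T χ GF g A A'` equals `nextAction T χ GF g A`), `normConst_eq_of_smallFieldStepOp` (and its `N` is `𝐍_k`),
   `pos_of_smallFieldStepOp`, **`smallFieldStepOp_iff`** (`SmallFieldStepOp T χ GF g A A' ↔ (∀ V, 0 < T(integrand) V) ∧ A' = nextAction …`),
   `smallFieldStepOp_unique`; the same over the carriers `RTOp`/`RTOpI` (`smallFieldStep_nextAction`, `smallFieldStepI_nextAction`,
   `eq_nextAction_of_smallFieldStep`, `eq_nextAction_of_smallFieldStepI`) by `rfl`.
§3 (0.17): `wilsonTerm`, `firstAction`, `firstAction_one`, `smallFieldStepOp_firstAction`.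
§4 the inductive sequence: `actionSeq` with `actionSeq_zero`/`actionSeq_succ` (and `printedSeq` = `actionSeq` started at
   `A_0 = −(1/g_0²)A`, with `printedSeq_one : A_1 = firstAction …` — (0.17) IS the first step, `rfl`); **`step_actionSeq`** (positivity at each step `k < K`
   ⇒ the one-step law (0.19) holds along the sequence — the `step` field of the cell's tower records, CONSTRUCTED);
   **`eq_actionSeq_of_steps`** (a sequence obeying the one-step law for `k < K` is `actionSeq` of its own `A 0` for all `k ≤ K` —
   «defined inductively»); the two tower records of the cell read through it: `eq_actionSeq_of_generatedBySteps`
   (`Step.GeneratedBySteps (Step.smallFieldLawOp Tk χ GF) …` of module `StepInhabited`, i.e. `Step.GeneratedBySmallFieldOp`) and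
   `eq_actionSeq_of_generatedBySmallFieldRT` (`Step.GeneratedBySmallFieldRT`, carrier `RTOp`).
§5 kernel form (0.13) (`B12FaddeevPopov016.KernelRT`): `normConst_kernelRT` / `nextAction_kernelRT_apply` (𝐍_k and A_{k+1} with print's
   integral sign, `rfl`); gauge invariance of the BODY, pointwise and WITHOUT positivity, for a kernel-form transformation (0.13) with a gauge invariant
   kernel and lift-invariant `χ`, `GF`, `A_k` (p. 254 «If ρ is a gauge invariant function, then Tρ is gauge invariant also», p. 263
   «the action A_k(U) … is gauge invariant»): **`nextAction_kernel_gaugeInvariant`**, by `B12RTGaugeInvariance254.kernelRT_gaugeAct_of_liftInvariant`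
   BY NAME (that file proves the invariance of any `A'` satisfying the step; here no step hypothesis is needed because `A_{k+1}` is a
   function of `T(…)`).
§6 (v1.1) (2.1) p. 265 as an INSTANCE of the body: `action21` (= `nextAction` at the (0.22)-form action `V ↦ −(1/g_k²)A(U_k(V)) +
   𝐄_k(U_k(V))`), `integrand_congr_support`/`normConst_congr_support`/`nextAction_congr_support` (the body depends on `A_k` only on
   `{χ_k ≠ 0}`), **`nextAction_eq_action21`** (`𝐓_kA_k = (2.1)` when `χ_k` is supported in the small-field domain and `A_k` has the
   form (0.22) there — print's two sentences as the two hypotheses), `nextAction_eq_action21_of_representation` (the same from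
   `Setup.EffActionSeq.Representation` by name), `Ek_eq_of_repr`/`Ek_eq_of_representation` («𝐄_k … is equal to (1/g_k²)A + A_k»).
NOT here (and not claimed): existence/positivity of the transformed densities for the printed data (the cell's `RTOp.pos` gives
`≥ 0` only; strict positivity is the hypothesis `hpos` where used — print takes the logarithm without comment).  SCOPE NOTE on
positivity: the cell's predicate asserts `T(χ_k e^{…}) = 𝐍_k e^{A_{k+1}}` at EVERY coarse configuration `V`, hence positivity of
the transformed density everywhere (`pos_of_smallFieldStepOp`), although print consumes `A_{k+1}` only on the small-field domain of
the next step; the body `nextAction` is TOTAL (Lean's `Real.log 0 = 0` off the positivity set) and agrees with print wherever the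
density is positive — the pointwise form `normConst_mul_exp_nextAction` carries exactly the two positivity hypotheses it uses
(at `V` and at `1`).  Also not here: the coupling
recursion (0.18)/(0.20), the representation (0.22)–(0.23) (r09 `B12Form13Step268`), convergence of anything.  Pre-existing
declarations at the same loci, imported and never re-declared: `Setup.SmallFieldStep`/`SmallFieldStepOp`/`SmallFieldStepI`,
`Step.GeneratedBySmallFieldRT`, `Step.GeneratedBySteps`/`Step.smallFieldLawOp`/`Step.GeneratedBySmallFieldOp` (module `StepInhabited`),
`B12RTGaugeInvariance254.*`, `B12FaddeevPopov016.KernelRT`.  Rows: B12.Eq0.17 / B12.Eq0.19 (display owner r09: located member,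
his head), B12.Def§0 (fold owner r20: cell token only).  Unit `lit-balaban-r20` (B12 fold owner / DEFINITIONS steward, gen 44;
TAKING line HOME/STATUS.md 2026-08-23T11:06Z, cc r09 / b2b / lead), HOME `run/shared/lean/pub/lit-balaban/`.
-/

namespace Literature.MathematicalPhysics.QuantumFieldTheory.Balaban1983to89.B12Eq019ActionBody

open Literature.MathematicalPhysics.QuantumFieldTheory.Balaban1983to89

noncomputable section

variable {P : Params} {G : Type*} [GaugeGroup G]

/-! ## §1. The body of (0.19): `A_{k+1}(V) = log 𝐍_k⁻¹ (T_k(χ_k e^{−GF/g_k² + A_k}))(V)`, `𝐍_k` = the same at `V = 1` -/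

section Body
variable {k : ℕ}

/-- The fine density under the renormalization transformation in (0.17)/(0.19): `χ_k(U)·exp[−(1/g_k²) GF(U) + A_k(g_k, U)]`
(`GF` = the gauge-fixing double sum `Σ_{y} Σ_{x∈B(y),x≠y}[1 − Re tr U(y,x)]`).  Definitionally the lambda inside
`Setup.SmallFieldStepOp`. [cite: Balaban1987RG1, (0.19) p.255] -/
def integrand (χ GF : Density P k G) (gk : ℝ) (A : Density P k G) : Density P k G :=
  fun U => χ U * Real.exp (-(1 / gk ^ 2) * GF U + A U)

omit [GaugeGroup G] in
/-- `integrand χ GF g A U = χ(U)·exp[−(1/g²)GF(U) + A(U)]`. [cite: Balaban1987RG1, (0.19) p.255] -/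
@[simp] theorem integrand_apply (χ GF : Density P k G) (gk : ℝ) (A : Density P k G) (U : GaugeField P k G) :
    integrand χ GF gk A U = χ U * Real.exp (-(1 / gk ^ 2) * GF U + A U) := rfl

omit [GaugeGroup G] in
/-- The integrand IS the density the cell's predicate `Setup.SmallFieldStepOp` transforms (definitional).
[cite: Balaban1987RG1, (0.19) p.255] -/
theorem integrand_eq (χ GF : Density P k G) (gk : ℝ) (A : Density P k G) :
    integrand χ GF gk A = fun U => χ U * Real.exp (-(1 / gk ^ 2) * GF U + A U) := rfl

/-- **The normalization constant `𝐍_k`** of (0.17)/(0.19): *«the constant 𝐍_k is given by the integral above with V = 1»* — the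
transformed density `T_k(χ_k e^{−GF/g_k² + A_k})` evaluated at the trivial configuration `V = 1`. [cite: Balaban1987RG1, (0.19) p.255–256] -/
def normConst (T : Density P k G → Density P (k+1) G) (χ GF : Density P k G) (gk : ℝ) (A : Density P k G) : ℝ :=
  T (integrand χ GF gk A) 1

/-- `𝐍_k = (T_k(χ_k e^{−GF/g_k² + A_k}))(1)`. [cite: Balaban1987RG1, (0.19) p.255–256] -/
theorem normConst_def (T : Density P k G → Density P (k+1) G) (χ GF : Density P k G) (gk : ℝ) (A : Density P k G) :
    normConst T χ GF gk A = T (integrand χ GF gk A) 1 := rfl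

/-- **(0.19) WITH BODY — the `(k+1)`-st small-field effective action `A_{k+1} = 𝐓_k A_k`:**
`A_{k+1}(g_{k+1}, V) = log 𝐍_k⁻¹ (T_k(χ_k exp[−(1/g_k²) GF + A_k(g_k, ·)]))(V)`, where in the cell's push-forward reading of (0.13)
the `δ`-function integral `∫dU Π_{c∈T⁽ᵏ⁺¹⁾} δ(Ū(c)V⁻¹(c)) (…)` is the operator `T_k` applied to the density `(…)`.
[cite: Balaban1987RG1, (0.19) p.255] -/
def nextAction (T : Density P k G → Density P (k+1) G) (χ GF : Density P k G) (gk : ℝ) (A : Density P k G) :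
    Density P (k+1) G :=
  fun V => Real.log ((normConst T χ GF gk A)⁻¹ * T (integrand χ GF gk A) V)

/-- `A_{k+1}(V) = log(𝐍_k⁻¹ · (T_k(χ_k e^{…}))(V))`. [cite: Balaban1987RG1, (0.19) p.255] -/
theorem nextAction_apply (T : Density P k G → Density P (k+1) G) (χ GF : Density P k G) (gk : ℝ) (A : Density P k G)
    (V : GaugeField P (k+1) G) :
    nextAction T χ GF gk A V = Real.log ((normConst T χ GF gk A)⁻¹ * T (integrand χ GF gk A) V) := rfl

/-- `A_{k+1}(V) = log((T_k(…))(V) / 𝐍_k)` (the same body as a quotient). [cite: Balaban1987RG1, (0.19) p.255] -/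
theorem nextAction_eq_log_div (T : Density P k G → Density P (k+1) G) (χ GF : Density P k G) (gk : ℝ) (A : Density P k G)
    (V : GaugeField P (k+1) G) :
    nextAction T χ GF gk A V = Real.log (T (integrand χ GF gk A) V / normConst T χ GF gk A) := by
  rw [nextAction_apply, div_eq_inv_mul]

/-- **`A_{k+1}(1) = 0`** — with `𝐍_k` *«given by the integral above with V = 1»* the new action vanishes at the trivial
configuration; UNCONDITIONAL (no positivity needed: `log(x⁻¹·x)` is `log 1 = 0` for `x ≠ 0` and `log 0 = 0` for `x = 0`).  This is
the clause `A' 1 = 0` that the cell's predicate `Setup.SmallFieldStepOp` carries as data, now a theorem of the body.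
[cite: Balaban1987RG1, (0.19) p.255–256] -/
@[simp] theorem nextAction_one (T : Density P k G → Density P (k+1) G) (χ GF : Density P k G) (gk : ℝ) (A : Density P k G) :
    nextAction T χ GF gk A 1 = 0 := by
  rw [nextAction_apply, normConst_def]
  by_cases h : T (integrand χ GF gk A) 1 = 0
  · simp [h]
  · rw [inv_mul_cancel₀ h, Real.log_one]

/-- **`𝐍_k · exp A_{k+1}(V) = (T_k(χ_k e^{−GF/g_k² + A_k}))(V)`** whenever the transformed density is positive at `V` and at `1`
(exponentiating (0.19)). [cite: Balaban1987RG1, (0.19) p.255] -/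
theorem normConst_mul_exp_nextAction (T : Density P k G → Density P (k+1) G) (χ GF : Density P k G) (gk : ℝ)
    (A : Density P k G) {V : GaugeField P (k+1) G} (hN : 0 < normConst T χ GF gk A) (hV : 0 < T (integrand χ GF gk A) V) :
    normConst T χ GF gk A * Real.exp (nextAction T χ GF gk A V) = T (integrand χ GF gk A) V := by
  rw [nextAction_apply, Real.exp_log (mul_pos (inv_pos.mpr hN) hV), ← mul_assoc, mul_inv_cancel₀ hN.ne', one_mul]

/-- `exp A_{k+1}(V) = 𝐍_k⁻¹ · (T_k(…))(V)` under positivity. [cite: Balaban1987RG1, (0.19) p.255] -/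
theorem exp_nextAction (T : Density P k G → Density P (k+1) G) (χ GF : Density P k G) (gk : ℝ) (A : Density P k G)
    {V : GaugeField P (k+1) G} (hN : 0 < normConst T χ GF gk A) (hV : 0 < T (integrand χ GF gk A) V) :
    Real.exp (nextAction T χ GF gk A V) = (normConst T χ GF gk A)⁻¹ * T (integrand χ GF gk A) V := by
  rw [nextAction_apply, Real.exp_log (mul_pos (inv_pos.mpr hN) hV)]

end Body

/-! ## §2. The cell's predicate `Setup.SmallFieldStepOp` characterised by the body -/

section Characterisation
variable {k : ℕ}

/-- **Positivity ⇒ the one-step law (0.19) holds for the body**: if the transformed density `T_k(χ_k e^{−GF/g_k² + A_k})` is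
positive everywhere, then `Setup.SmallFieldStepOp T χ GF g_k A_k (nextAction T χ GF g_k A_k)` — with the witness `N = 𝐍_k`.
[cite: Balaban1987RG1, (0.19) p.255] -/
theorem smallFieldStepOp_nextAction (T : Density P k G → Density P (k+1) G) (χ GF : Density P k G) (gk : ℝ)
    (A : Density P k G) (hpos : ∀ V, 0 < T (integrand χ GF gk A) V) :
    SmallFieldStepOp T χ GF gk A (nextAction T χ GF gk A) := by
  have hN : 0 < normConst T χ GF gk A := hpos 1
  refine ⟨normConst T χ GF gk A, hN, ?_, nextAction_one T χ GF gk A⟩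
  funext V
  exact (normConst_mul_exp_nextAction T χ GF gk A hN (hpos V)).symm

/-- From an equality of functions `T(…) = (V ↦ N·e^{A'(V)})` at `V = 1` with `A'(1) = 0`: `N = 𝐍_k`. [cite: Balaban1987RG1, (0.19) p.255–256] -/
theorem normConst_eq_of_eq {T : Density P k G → Density P (k+1) G} {χ GF : Density P k G} {gk : ℝ} {A : Density P k G}
    {A' : Density P (k+1) G} {N : ℝ}
    (hT : T (fun U => χ U * Real.exp (-(1 / gk ^ 2) * GF U + A U)) = fun V => N * Real.exp (A' V)) (h1 : A' 1 = 0) :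
    normConst T χ GF gk A = N := by
  rw [normConst_def, integrand_eq, hT]
  simp [h1]

/-- **The constant of a small-field step IS `𝐍_k`**: for every witness `N` of `Setup.SmallFieldStepOp T χ GF g_k A_k A'`
(i.e. `N > 0`, `T(χ·e^{…}) = N·e^{A'}`, `A'(1) = 0`), `N = normConst T χ GF g_k A_k`. [cite: Balaban1987RG1, (0.19) p.255–256] -/
theorem normConst_eq_of_smallFieldStepOp {T : Density P k G → Density P (k+1) G} {χ GF : Density P k G} {gk : ℝ}
    {A : Density P k G} {A' : Density P (k+1) G} {N : ℝ}
    (h : 0 < N ∧ T (fun U => χ U * Real.exp (-(1 / gk ^ 2) * GF U + A U)) = (fun V => N * Real.exp (A' V)) ∧ A' 1 = 0) :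
    N = normConst T χ GF gk A :=
  (normConst_eq_of_eq h.2.1 h.2.2).symm

/-- A small-field step makes the transformed density positive everywhere (`= N·e^{A'(V)}`, `N > 0`).
[cite: Balaban1987RG1, (0.19) p.255] -/
theorem pos_of_smallFieldStepOp {T : Density P k G → Density P (k+1) G} {χ GF : Density P k G} {gk : ℝ}
    {A : Density P k G} {A' : Density P (k+1) G} (h : SmallFieldStepOp T χ GF gk A A') (V : GaugeField P (k+1) G) :
    0 < T (integrand χ GF gk A) V := by
  obtain ⟨N, hN, hT, -⟩ := h
  rw [integrand_eq, hT]
  exact mul_pos hN (Real.exp_pos _)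

/-- A small-field step makes `𝐍_k > 0`. [cite: Balaban1987RG1, (0.19) p.255–256] -/
theorem normConst_pos_of_smallFieldStepOp {T : Density P k G → Density P (k+1) G} {χ GF : Density P k G} {gk : ℝ}
    {A : Density P k G} {A' : Density P (k+1) G} (h : SmallFieldStepOp T χ GF gk A A') :
    0 < normConst T χ GF gk A :=
  pos_of_smallFieldStepOp h 1

/-- **THE DEFINITION IS FORCED**: any `A'` related to `A_k` by the cell's predicate `Setup.SmallFieldStepOp T χ GF g_k A_k A'`
(`T(χ_k e^{−GF/g_k² + A_k}) = N·e^{A'}`, `N > 0`, `A'(1) = 0`) IS the body (0.19): `A' = nextAction T χ GF g_k A_k`.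
[cite: Balaban1987RG1, (0.19) p.255] -/
theorem eq_nextAction_of_smallFieldStepOp {T : Density P k G → Density P (k+1) G} {χ GF : Density P k G} {gk : ℝ}
    {A : Density P k G} {A' : Density P (k+1) G} (h : SmallFieldStepOp T χ GF gk A A') :
    A' = nextAction T χ GF gk A := by
  obtain ⟨N, hN, hT, h1⟩ := h
  have hNk : normConst T χ GF gk A = N := normConst_eq_of_eq hT h1
  funext V
  rw [nextAction_apply, hNk, integrand_eq, hT]
  simp only
  rw [← mul_assoc, inv_mul_cancel₀ hN.ne', one_mul, Real.log_exp]

/-- **(0.19) as a characterisation of the cell's predicate**: `Setup.SmallFieldStepOp T χ GF g_k A_k A'` holds iff the transformed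
density is positive everywhere and `A'` is the body `nextAction T χ GF g_k A_k`. [cite: Balaban1987RG1, (0.19) p.255] -/
theorem smallFieldStepOp_iff (T : Density P k G → Density P (k+1) G) (χ GF : Density P k G) (gk : ℝ) (A : Density P k G)
    (A' : Density P (k+1) G) :
    SmallFieldStepOp T χ GF gk A A' ↔ (∀ V, 0 < T (integrand χ GF gk A) V) ∧ A' = nextAction T χ GF gk A := by
  constructor
  · exact fun h => ⟨pos_of_smallFieldStepOp h, eq_nextAction_of_smallFieldStepOp h⟩
  · rintro ⟨hpos, rfl⟩
    exact smallFieldStepOp_nextAction T χ GF gk A hpos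

/-- Uniqueness of the new action in the cell's predicate: two `A'`, `A''` related to the same `A_k` by `Setup.SmallFieldStepOp`
coincide. [cite: Balaban1987RG1, (0.19) p.255] -/
theorem smallFieldStepOp_unique {T : Density P k G → Density P (k+1) G} {χ GF : Density P k G} {gk : ℝ} {A : Density P k G}
    {A' A'' : Density P (k+1) G} (h' : SmallFieldStepOp T χ GF gk A A') (h'' : SmallFieldStepOp T χ GF gk A A'') :
    A' = A'' := by
  rw [eq_nextAction_of_smallFieldStepOp h', eq_nextAction_of_smallFieldStepOp h'']

variable [MeasurableSpace G] [HaarData G]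

/-- The same over the carrier `RTOp` of `Step` Part B2 (`Setup.SmallFieldStep`, `= SmallFieldStepOp T.T …` by `rfl`):
positivity ⇒ the step holds for the body. [cite: Balaban1987RG1, (0.19) p.255] -/
theorem smallFieldStep_nextAction {av : Averaging P k G} (T : RTOp P k G av) (χ GF : Density P k G) (gk : ℝ)
    (A : Density P k G) (hpos : ∀ V, 0 < T.T (integrand χ GF gk A) V) :
    SmallFieldStep T χ GF gk A (nextAction T.T χ GF gk A) :=
  smallFieldStepOp_nextAction T.T χ GF gk A hpos

/-- The same over the inhabited carrier `RTOpI` (`Setup.SmallFieldStepI`). [cite: Balaban1987RG1, (0.19) p.255] -/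
theorem smallFieldStepI_nextAction {av : Averaging P k G} (T : RTOpI P k G av) (χ GF : Density P k G) (gk : ℝ)
    (A : Density P k G) (hpos : ∀ V, 0 < T.T (integrand χ GF gk A) V) :
    SmallFieldStepI T χ GF gk A (nextAction T.T χ GF gk A) :=
  smallFieldStepOp_nextAction T.T χ GF gk A hpos

/-- Over `RTOp`: the `A'` of a `Setup.SmallFieldStep` is the body. [cite: Balaban1987RG1, (0.19) p.255] -/
theorem eq_nextAction_of_smallFieldStep {av : Averaging P k G} {T : RTOp P k G av} {χ GF : Density P k G} {gk : ℝ}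
    {A : Density P k G} {A' : Density P (k+1) G} (h : SmallFieldStep T χ GF gk A A') : A' = nextAction T.T χ GF gk A :=
  eq_nextAction_of_smallFieldStepOp h

/-- Over `RTOpI`: the `A'` of a `Setup.SmallFieldStepI` is the body. [cite: Balaban1987RG1, (0.19) p.255] -/
theorem eq_nextAction_of_smallFieldStepI {av : Averaging P k G} {T : RTOpI P k G av} {χ GF : Density P k G} {gk : ℝ}
    {A : Density P k G} {A' : Density P (k+1) G} (h : SmallFieldStepI T χ GF gk A A') : A' = nextAction T.T χ GF gk A :=
  eq_nextAction_of_smallFieldStepOp h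

end Characterisation

/-! ## §3. (0.17): the first step `A₁ = 𝐓₀A`, `A` the Wilson action with the factor `−1/g₀²` -/

section FirstStep
variable {k : ℕ}

/-- The action under the first transformation (0.17): `A_0(U) := −(1/g₀²) A(U)`, `A` = the Wilson action (0.2) (`Setup.wilsonAction w`,
weight `w = ε^{d−4}`, `= 1` for `d = 4`). [cite: Balaban1987RG1, (0.17) p.255] -/
def wilsonTerm (g₀ w : ℝ) : Density P k G :=
  fun U => -(1 / g₀ ^ 2) * wilsonAction w U

/-- `wilsonTerm g₀ w U = −(1/g₀²)·A^w(U)`. [cite: Balaban1987RG1, (0.17) p.255] -/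
@[simp] theorem wilsonTerm_apply (g₀ w : ℝ) (U : GaugeField P k G) :
    wilsonTerm g₀ w U = -(1 / g₀ ^ 2) * wilsonAction w U := rfl

/-- **(0.17) WITH BODY — the first small-field effective action `A₁ = 𝐓₀A`:**
`A₁(V) = log 𝐍₀⁻¹ (T₀(χ₀ exp[−(1/g₀²) GF − (1/g₀²) A]))(V)` = the general step (0.19) at `A_0 = −(1/g₀²)A`.
[cite: Balaban1987RG1, (0.17) p.255] -/
def firstAction (T : Density P k G → Density P (k+1) G) (χ GF : Density P k G) (g₀ w : ℝ) : Density P (k+1) G :=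
  nextAction T χ GF g₀ (wilsonTerm g₀ w)

/-- `A₁ = 𝐓₀A` is the step (0.19) applied to `−(1/g₀²)A` (definitional). [cite: Balaban1987RG1, (0.17) p.255] -/
theorem firstAction_eq (T : Density P k G → Density P (k+1) G) (χ GF : Density P k G) (g₀ w : ℝ) :
    firstAction T χ GF g₀ w = nextAction T χ GF g₀ (wilsonTerm g₀ w) := rfl

/-- The exponent of (0.17) as printed: `−(1/g₀²)·GF(U) − (1/g₀²)·A(U)`. [cite: Balaban1987RG1, (0.17) p.255] -/
theorem integrand_wilsonTerm_apply (χ GF : Density P k G) (g₀ w : ℝ) (U : GaugeField P k G) :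
    integrand χ GF g₀ (wilsonTerm g₀ w) U =
      χ U * Real.exp (-(1 / g₀ ^ 2) * GF U - (1 / g₀ ^ 2) * wilsonAction w U) := by
  rw [integrand_apply, wilsonTerm_apply]
  ring_nf

/-- `A₁(1) = 0` (*«the normalization factor 𝐍₀ is given by the same integral as above, but with V = 1»*).
[cite: Balaban1987RG1, (0.17) p.255] -/
@[simp] theorem firstAction_one (T : Density P k G → Density P (k+1) G) (χ GF : Density P k G) (g₀ w : ℝ) :
    firstAction T χ GF g₀ w 1 = 0 :=
  nextAction_one T χ GF g₀ _

/-- Positivity ⇒ the first step satisfies the cell's predicate with `A_0 = −(1/g₀²)A`. [cite: Balaban1987RG1, (0.17) p.255] -/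
theorem smallFieldStepOp_firstAction (T : Density P k G → Density P (k+1) G) (χ GF : Density P k G) (g₀ w : ℝ)
    (hpos : ∀ V, 0 < T (integrand χ GF g₀ (wilsonTerm g₀ w)) V) :
    SmallFieldStepOp T χ GF g₀ (wilsonTerm g₀ w) (firstAction T χ GF g₀ w) :=
  smallFieldStepOp_nextAction T χ GF g₀ _ hpos

end FirstStep

/-! ## §4. «The sequence of actions … is defined for k = 0, 1, …, K»: the inductive definition and the cell's tower records -/

section Sequence

/-- **The inductively defined sequence of small-field effective actions** `A_0, A_1, A_2, …` (p. 256 *«the sequence of actions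
and coupling constants is defined for k = 0, 1, …, K»*, Theorem 3 p. 264 *«defined inductively by the small field renormalization
transformations T_k»*): `A_0 := A₀` and `A_{k+1} := 𝐓_k A_k = nextAction (T_k) (χ_k) (GF_k) (g_k) (A_k)`, for a family of
transformation operators `Tk k`, characteristic functions `χ k`, gauge-fixing terms `GF k` and a coupling sequence `g`.
[cite: Balaban1987RG1, (0.19) p.255–256] -/
def actionSeq (Tk : ∀ k, Density P k G → Density P (k+1) G) (χ GF : ∀ k, Density P k G) (g : ℕ → ℝ)
    (A₀ : Density P 0 G) : ∀ k, Density P k G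
  | 0 => A₀
  | k + 1 => nextAction (Tk k) (χ k) (GF k) (g k) (actionSeq Tk χ GF g A₀ k)

/-- `A_0 = A₀`. [cite: Balaban1987RG1, (0.19) p.255–256] -/
@[simp] theorem actionSeq_zero (Tk : ∀ k, Density P k G → Density P (k+1) G) (χ GF : ∀ k, Density P k G) (g : ℕ → ℝ)
    (A₀ : Density P 0 G) : actionSeq Tk χ GF g A₀ 0 = A₀ := rfl

/-- `A_{k+1} = 𝐓_k A_k`. [cite: Balaban1987RG1, (0.19) p.255–256] -/
theorem actionSeq_succ (Tk : ∀ k, Density P k G → Density P (k+1) G) (χ GF : ∀ k, Density P k G) (g : ℕ → ℝ)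
    (A₀ : Density P 0 G) (k : ℕ) :
    actionSeq Tk χ GF g A₀ (k + 1) = nextAction (Tk k) (χ k) (GF k) (g k) (actionSeq Tk χ GF g A₀ k) := rfl

/-- Every action of the sequence after the first vanishes at `V = 1`. [cite: Balaban1987RG1, (0.19) p.255–256] -/
@[simp] theorem actionSeq_succ_one (Tk : ∀ k, Density P k G → Density P (k+1) G) (χ GF : ∀ k, Density P k G) (g : ℕ → ℝ)
    (A₀ : Density P 0 G) (k : ℕ) : actionSeq Tk χ GF g A₀ (k + 1) 1 = 0 :=
  nextAction_one _ _ _ _ _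

/-- **The one-step law (0.19) along the sequence, CONSTRUCTED**: if at each step `k < K` the transformed density
`T_k(χ_k e^{−GF_k/g_k² + A_k})` is positive, then `Setup.SmallFieldStepOp (Tk k) (χ k) (GF k) (g k) (A_k) (A_{k+1})` for all `k < K`
— the `step` field of the cell's tower records (`Step.GeneratedBySmallFieldRT`, `StepInhabited.GeneratedBySteps`) for
`A := actionSeq …`. [cite: Balaban1987RG1, (0.19) p.255–256] -/
theorem step_actionSeq (Tk : ∀ k, Density P k G → Density P (k+1) G) (χ GF : ∀ k, Density P k G) (g : ℕ → ℝ)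
    (A₀ : Density P 0 G) {K : ℕ}
    (hpos : ∀ k, k < K → ∀ V, 0 < Tk k (integrand (χ k) (GF k) (g k) (actionSeq Tk χ GF g A₀ k)) V) :
    ∀ k, k < K → SmallFieldStepOp (Tk k) (χ k) (GF k) (g k) (actionSeq Tk χ GF g A₀ k) (actionSeq Tk χ GF g A₀ (k + 1)) :=
  fun k hk => smallFieldStepOp_nextAction (Tk k) (χ k) (GF k) (g k) _ (hpos k hk)

/-- **«Defined inductively»: a sequence obeying the one-step law IS the inductive sequence of its first term.**  If
`A : ∀ k, Density P k G` satisfies `Setup.SmallFieldStepOp (Tk k) (χ k) (GF k) (g k) (A k) (A (k+1))` for every `k < K`, then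
`A k = actionSeq Tk χ GF g (A 0) k` for every `k ≤ K`. [cite: Balaban1987RG1, (0.19) p.255–256] -/
theorem eq_actionSeq_of_steps {Tk : ∀ k, Density P k G → Density P (k+1) G} {χ GF : ∀ k, Density P k G} {g : ℕ → ℝ}
    {A : ∀ k, Density P k G} {K : ℕ} (hstep : ∀ k, k < K → SmallFieldStepOp (Tk k) (χ k) (GF k) (g k) (A k) (A (k + 1))) :
    ∀ k, k ≤ K → A k = actionSeq Tk χ GF g (A 0) k := by
  intro k
  induction k with
  | zero => intro; rfl
  | succ k ih =>
    intro hk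
    have hk' : k < K := Nat.lt_of_succ_le hk
    rw [actionSeq_succ, ← ih hk'.le]
    exact eq_nextAction_of_smallFieldStepOp (hstep k hk')

/-- With the positivity side condition the converse holds too: the sequences obeying the one-step law for `k < K` and starting at
`A₀` are exactly those agreeing with `actionSeq … A₀` up to `K`. [cite: Balaban1987RG1, (0.19) p.255–256] -/
theorem steps_iff_eq_actionSeq {Tk : ∀ k, Density P k G → Density P (k+1) G} {χ GF : ∀ k, Density P k G} {g : ℕ → ℝ}
    {A : ∀ k, Density P k G} {A₀ : Density P 0 G} {K : ℕ} (h0 : A 0 = A₀)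
    (hpos : ∀ k, k < K → ∀ V, 0 < Tk k (integrand (χ k) (GF k) (g k) (actionSeq Tk χ GF g A₀ k)) V) :
    (∀ k, k < K → SmallFieldStepOp (Tk k) (χ k) (GF k) (g k) (A k) (A (k + 1))) ↔
      ∀ k, k ≤ K → A k = actionSeq Tk χ GF g A₀ k := by
  constructor
  · intro hstep k hk
    rw [eq_actionSeq_of_steps hstep k hk, h0]
  · intro heq k hk
    rw [heq k hk.le, heq (k + 1) hk]
    exact step_actionSeq Tk χ GF g A₀ hpos k hk

/-- **The printed sequence itself**: `A_0 := −(1/g_0²)A` (the Wilson action (0.2) with its coupling, the exponent of (0.17)) and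
`A_{k+1} := 𝐓_k A_k` (0.19) at the couplings `g_k` — «the sequence of actions and coupling constants is defined for k = 0, 1, …, K».
[cite: Balaban1987RG1, (0.17)–(0.19) p.255–256] -/
def printedSeq (Tk : ∀ k, Density P k G → Density P (k+1) G) (χ GF : ∀ k, Density P k G) (g : ℕ → ℝ) (w : ℝ) :
    ∀ k, Density P k G :=
  actionSeq Tk χ GF g (wilsonTerm (g 0) w)

/-- `A_0 = −(1/g_0²)A`. [cite: Balaban1987RG1, (0.17) p.255] -/
@[simp] theorem printedSeq_zero (Tk : ∀ k, Density P k G → Density P (k+1) G) (χ GF : ∀ k, Density P k G) (g : ℕ → ℝ)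
    (w : ℝ) : printedSeq Tk χ GF g w 0 = wilsonTerm (g 0) w := rfl

/-- **(0.17) is the first step of the sequence**: `A_1 = 𝐓_0 A = firstAction (T_0) (χ_0) (GF_0) (g_0)` (definitional).
[cite: Balaban1987RG1, (0.17) p.255] -/
theorem printedSeq_one (Tk : ∀ k, Density P k G → Density P (k+1) G) (χ GF : ∀ k, Density P k G) (g : ℕ → ℝ) (w : ℝ) :
    printedSeq Tk χ GF g w 1 = firstAction (Tk 0) (χ 0) (GF 0) (g 0) w := rfl

/-- `A_{k+1} = 𝐓_k A_k` along the printed sequence. [cite: Balaban1987RG1, (0.19) p.255] -/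
theorem printedSeq_succ (Tk : ∀ k, Density P k G → Density P (k+1) G) (χ GF : ∀ k, Density P k G) (g : ℕ → ℝ) (w : ℝ)
    (k : ℕ) : printedSeq Tk χ GF g w (k + 1) = nextAction (Tk k) (χ k) (GF k) (g k) (printedSeq Tk χ GF g w k) := rfl

/-- The one-step law along the printed sequence under positivity (instance of `step_actionSeq`).
[cite: Balaban1987RG1, (0.19) p.255–256] -/
theorem step_printedSeq (Tk : ∀ k, Density P k G → Density P (k+1) G) (χ GF : ∀ k, Density P k G) (g : ℕ → ℝ) (w : ℝ)
    {K : ℕ} (hpos : ∀ k, k < K → ∀ V, 0 < Tk k (integrand (χ k) (GF k) (g k) (printedSeq Tk χ GF g w k)) V) :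
    ∀ k, k < K → SmallFieldStepOp (Tk k) (χ k) (GF k) (g k) (printedSeq Tk χ GF g w k) (printedSeq Tk χ GF g w (k + 1)) :=
  step_actionSeq Tk χ GF g _ hpos

variable {Φ 𝒢 : Type*}

/-- **The cell's operator-level tower record read through the body**: in `Step.GeneratedBySteps (Step.smallFieldLawOp Tk χ GF) bg A T K`
(module `StepInhabited`; = `Step.GeneratedBySmallFieldOp Tk χ GF bg A T K`, B12 Thm 3's «sequence of actions A_k defined inductively …») the datum
`A` IS the inductive sequence (0.17)/(0.19) of its first term at the couplings `T.flow.g`: `A k = actionSeq Tk χ GF T.flow.g (A 0) k`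
for `k ≤ K`. [cite: Balaban1987RG1, (0.17)–(0.20) p.255–256] -/
theorem eq_actionSeq_of_generatedBySteps {av : ∀ j, Averaging P j G} {Tk : ∀ k, Density P k G → Density P (k+1) G}
    {χ GF : ∀ k, Density P k G} {bg : Background P G av} {A : ∀ k, Density P k G} {T : Step.SFTower P G Φ 𝒢} {K : ℕ}
    (h : Step.GeneratedBySteps (Step.smallFieldLawOp Tk χ GF) bg A T K) :
    ∀ k, k ≤ K → A k = actionSeq Tk χ GF T.flow.g (A 0) k :=
  eq_actionSeq_of_steps h.step

variable [MeasurableSpace G] [HaarData G]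

/-- **The cell's `RTOp`-level tower record read through the body**: in `Step.GeneratedBySmallFieldRT av Tk χ GF bg A T K` the datum
`A` IS the inductive sequence (0.17)/(0.19) of its first term: `A k = actionSeq (fun k => (Tk k).T) χ GF T.flow.g (A 0) k` for
`k ≤ K`. [cite: Balaban1987RG1, (0.17)–(0.20) p.255–256] -/
theorem eq_actionSeq_of_generatedBySmallFieldRT {av : ∀ j, Averaging P j G} {Tk : ∀ k, RTOp P k G (av k)}
    {χ GF : ∀ k, Density P k G} {bg : Background P G av} {A : ∀ k, Density P k G} {T : Step.SFTower P G Φ 𝒢} {K : ℕ}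
    (h : Step.GeneratedBySmallFieldRT av Tk χ GF bg A T K) :
    ∀ k, k ≤ K → A k = actionSeq (fun k => (Tk k).T) χ GF T.flow.g (A 0) k :=
  eq_actionSeq_of_steps h.step

/-- Over `RTOp`: positivity at each step ⇒ the `step` field of `Step.GeneratedBySmallFieldRT` holds for `A := actionSeq …`.
[cite: Balaban1987RG1, (0.19) p.255–256] -/
theorem smallFieldStep_actionSeq {av : ∀ j, Averaging P j G} (Tk : ∀ k, RTOp P k G (av k)) (χ GF : ∀ k, Density P k G)
    (g : ℕ → ℝ) (A₀ : Density P 0 G) {K : ℕ}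
    (hpos : ∀ k, k < K → ∀ V, 0 < (Tk k).T (integrand (χ k) (GF k) (g k) (actionSeq (fun k => (Tk k).T) χ GF g A₀ k)) V) :
    ∀ k, k < K → SmallFieldStep (Tk k) (χ k) (GF k) (g k) (actionSeq (fun k => (Tk k).T) χ GF g A₀ k)
      (actionSeq (fun k => (Tk k).T) χ GF g A₀ (k + 1)) :=
  step_actionSeq (fun k => (Tk k).T) χ GF g A₀ hpos

end Sequence

/-! ## §5. Gauge invariance of the body for a kernel-form transformation (p. 254, p. 263), pointwise, no positivity needed -/

section Gauge
variable {j : ℕ} [MeasurableSpace G] [HaarData G] [MeasurableMul₂ G]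

omit [MeasurableMul₂ G] in
open _root_.MeasureTheory in
/-- In the kernel form (0.13) `(Tρ)(V) = ∫dU t(V,U)ρ(U)` the normalization constant is LITERALLY *«the integral above with V = 1»*:
`𝐍_k = ∫dU t(1,U) χ_k(U) exp[−(1/g_k²)GF(U) + A_k(U)]`. [cite: Balaban1987RG1, (0.19) p.255–256] -/
theorem normConst_kernelRT (kr : B12FaddeevPopov016.KernelRT P j G) (χ GF : Density P j G) (gk : ℝ) (A : Density P j G) :
    normConst kr.T χ GF gk A =
      ∫ U, kr.t 1 U * (χ U * Real.exp (-(1 / gk ^ 2) * GF U + A U)) ∂(fieldMeasure P j G) := rfl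

omit [MeasurableMul₂ G] in
open _root_.MeasureTheory in
/-- In the kernel form (0.13) the body reads `A_{k+1}(V) = log 𝐍_k⁻¹ ∫dU t(V,U) χ_k(U) exp[−(1/g_k²)GF(U) + A_k(U)]` — (0.19) with
print's integral sign. [cite: Balaban1987RG1, (0.19) p.255] -/
theorem nextAction_kernelRT_apply (kr : B12FaddeevPopov016.KernelRT P j G) (χ GF : Density P j G) (gk : ℝ)
    (A : Density P j G) (V : GaugeField P (j+1) G) :
    nextAction kr.T χ GF gk A V = Real.log ((normConst kr.T χ GF gk A)⁻¹ *
      ∫ U, kr.t V U * (χ U * Real.exp (-(1 / gk ^ 2) * GF U + A U)) ∂(fieldMeasure P j G)) := rfl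

open B12RTGaugeInvariance254 in
/-- **The new action is gauge invariant** (p. 254 *«If ρ is a gauge invariant function, then Tρ is gauge invariant also»*, p. 263
*«the action A_k(U) … is gauge invariant»*), for the BODY (0.19) and POINTWISE: for a transformation in the kernel form (0.13)
`(Tρ)(V) = ∫dU t(V,U)ρ(U)` with a gauge invariant kernel (`B12RTGaugeInvariance254.KernelGaugeInvariant`) and `χ`, `GF`, `A_k`
invariant under the block-constant gauge transformations (`LiftInvariant`), `A_{k+1}(V^v) = A_{k+1}(V)` for every coarse `v` and every
`V` — by `B12RTGaugeInvariance254.kernelRT_gaugeAct_of_liftInvariant` BY NAME; no step/positivity hypothesis is needed because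
`A_{k+1}` is a function of `T(χ e^{…})`. [cite: Balaban1987RG1, (0.13) p.254] -/
theorem nextAction_kernel_gaugeInvariant (hj : j + 1 ≤ P.m + P.K) {kr : B12FaddeevPopov016.KernelRT P j G}
    (hk : KernelGaugeInvariant kr) {χ GF A : Density P j G} (hχ : LiftInvariant χ) (hGF : LiftInvariant GF)
    (hA : LiftInvariant A) (gk : ℝ) : GaugeField.GaugeInvariant (nextAction kr.T χ GF gk A) := by
  intro v V
  rw [nextAction_apply, nextAction_apply, integrand_eq,
    kernelRT_gaugeAct_of_liftInvariant hj hk (liftInvariant_sfDensity hχ hGF hA gk) v V]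

open B12RTGaugeInvariance254 in
/-- The same for the first step (0.17) with a lift-invariant Wilson term. [cite: Balaban1987RG1, (0.17) p.255] -/
theorem firstAction_kernel_gaugeInvariant (hj : j + 1 ≤ P.m + P.K) {kr : B12FaddeevPopov016.KernelRT P j G}
    (hk : KernelGaugeInvariant kr) {χ GF : Density P j G} (hχ : LiftInvariant χ) (hGF : LiftInvariant GF) (g₀ w : ℝ)
    (hA : LiftInvariant (wilsonTerm (P := P) (G := G) (k := j) g₀ w)) :
    GaugeField.GaugeInvariant (firstAction kr.T χ GF g₀ w) :=
  nextAction_kernel_gaugeInvariant hj hk hχ hGF hA g₀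

end Gauge

/-! ## §6 (v1.1). (2.1) p. 265: the step applied to an action of the form (0.22) — an INSTANCE of the body (0.19) -/

section Eq21
variable {k : ℕ}

omit [GaugeGroup G] in
/-- The body depends on `A_k` only on the support of `χ_k`: if `A = A'` wherever `χ_k ≠ 0`, the integrands coincide
(*«the domain of integration in (2.1) is restricted to configurations V for which U_k(V) ∈ U_k(ε₀)»*, p. 265).
[cite: Balaban1987RG1, (2.1) p.265] -/
theorem integrand_congr_support {χ GF : Density P k G} {gk : ℝ} {A A' : Density P k G}
    (h : ∀ U, χ U ≠ 0 → A U = A' U) : integrand χ GF gk A = integrand χ GF gk A' := by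
  funext U
  by_cases hχ : χ U = 0
  · simp [integrand_apply, hχ]
  · rw [integrand_apply, integrand_apply, h U hχ]

/-- Hence `𝐍_k` depends on `A_k` only on the support of `χ_k`. [cite: Balaban1987RG1, (2.1) p.265] -/
theorem normConst_congr_support (T : Density P k G → Density P (k+1) G) {χ GF : Density P k G} {gk : ℝ}
    {A A' : Density P k G} (h : ∀ U, χ U ≠ 0 → A U = A' U) :
    normConst T χ GF gk A = normConst T χ GF gk A' := by
  rw [normConst_def, normConst_def, integrand_congr_support h]

/-- Hence `A_{k+1} = 𝐓_k A_k` depends on `A_k` only on the support of `χ_k`. [cite: Balaban1987RG1, (2.1) p.265] -/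
theorem nextAction_congr_support (T : Density P k G → Density P (k+1) G) {χ GF : Density P k G} {gk : ℝ}
    {A A' : Density P k G} (h : ∀ U, χ U ≠ 0 → A U = A' U) :
    nextAction T χ GF gk A = nextAction T χ GF gk A' := by
  funext V
  rw [nextAction_apply, nextAction_apply, normConst_congr_support T h, integrand_congr_support h]

/-- **(2.1) WITH BODY**: `(𝐓_kA_k)(W) = log 𝐍_k⁻¹ ∫dV δ(V̄W⁻¹) χ_k exp[−(1/g_k²)𝐆(V) − (1/g_k²)A(U_k(V)) + 𝐄_k(U_k(V))]` —
the step (0.19) applied to the action of the form (0.22) `V ↦ −(1/g_k²)A(U_k(V)) + 𝐄_k(U_k(V))` (`Uk` = the background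
field `V ↦ U_k(V)`, `Aη` = the Wilson action `A = A^η` on the fine lattice, `Ek` = `𝐄_k`). [cite: Balaban1987RG1, (2.1) p.265] -/
def action21 (T : Density P k G → Density P (k+1) G) (χ GF : Density P k G) (gk : ℝ)
    (Uk : GaugeField P k G → GaugeField P 0 G) (Aη Ek : GaugeField P 0 G → ℝ) : Density P (k+1) G :=
  nextAction T χ GF gk (fun V => -(1 / gk ^ 2) * Aη (Uk V) + Ek (Uk V))

/-- (2.1) is the body (0.19) at the (0.22)-form action (definitional). [cite: Balaban1987RG1, (2.1) p.265] -/
theorem action21_eq (T : Density P k G → Density P (k+1) G) (χ GF : Density P k G) (gk : ℝ)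
    (Uk : GaugeField P k G → GaugeField P 0 G) (Aη Ek : GaugeField P 0 G → ℝ) :
    action21 T χ GF gk Uk Aη Ek = nextAction T χ GF gk (fun V => -(1 / gk ^ 2) * Aη (Uk V) + Ek (Uk V)) := rfl

omit [GaugeGroup G] in
/-- The exponent of (2.1) as printed: `−(1/g_k²)𝐆(V) − (1/g_k²)A(U_k(V)) + 𝐄_k(U_k(V))`. [cite: Balaban1987RG1, (2.1) p.265] -/
theorem integrand_action21_apply (χ GF : Density P k G) (gk : ℝ) (Uk : GaugeField P k G → GaugeField P 0 G)
    (Aη Ek : GaugeField P 0 G → ℝ) (V : GaugeField P k G) :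
    integrand χ GF gk (fun V => -(1 / gk ^ 2) * Aη (Uk V) + Ek (Uk V)) V =
      χ V * Real.exp (-(1 / gk ^ 2) * GF V - (1 / gk ^ 2) * Aη (Uk V) + Ek (Uk V)) := by
  rw [integrand_apply]
  ring_nf

/-- **`(𝐓_kA_k)(W) = (2.1)`** (p. 265: *«We assume that after k steps we have obtained the action A_k described in the
previous section, and we apply the next renormalization transformation 𝐓_k restricted to a small field region by a
characteristic function χ_k»*): if `χ_k` vanishes off a small-field domain `dom` (*«the domain of integration in (2.1)
is restricted to configurations V for which U_k(V) ∈ U_k(ε₀)»*) and `A_k` has the form (0.22) on `dom` (*«the inductive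
assumption of the previous section is valid for the action A_k(U_k(V))»*), then `𝐓_kA_k = action21 …`.
[cite: Balaban1987RG1, (2.1) p.265] -/
theorem nextAction_eq_action21 (T : Density P k G → Density P (k+1) G) {χ : Density P k G} (GF : Density P k G)
    (gk : ℝ) {A : Density P k G} {dom : Set (GaugeField P k G)} {Uk : GaugeField P k G → GaugeField P 0 G}
    {Aη Ek : GaugeField P 0 G → ℝ} (hχ : ∀ V, χ V ≠ 0 → V ∈ dom)
    (h022 : ∀ V ∈ dom, A V = -(1 / gk ^ 2) * Aη (Uk V) + Ek (Uk V)) :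
    nextAction T χ GF gk A = action21 T χ GF gk Uk Aη Ek :=
  nextAction_congr_support T fun V hV => h022 V (hχ V hV)

omit [GaugeGroup G] in
/-- *«The meaning of the function 𝐄_k is obvious, it is equal to (1/g_k²)A + A_k»* — on the domain where (0.22) holds:
`𝐄_k(U_k(V)) = (1/g_k²)A(U_k(V)) + A_k(V)`. [cite: Balaban1987RG1, (2.1) p.265] -/
theorem Ek_eq_of_repr {gk : ℝ} {A : Density P k G} {dom : Set (GaugeField P k G)}
    {Uk : GaugeField P k G → GaugeField P 0 G} {Aη Ek : GaugeField P 0 G → ℝ}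
    (h022 : ∀ V ∈ dom, A V = -(1 / gk ^ 2) * Aη (Uk V) + Ek (Uk V)) {V : GaugeField P k G} (hV : V ∈ dom) :
    Ek (Uk V) = (1 / gk ^ 2) * Aη (Uk V) + A V := by
  rw [h022 V hV]
  ring

/-- **The same from the cell's representation record**: for a sequence of effective actions `S : Setup.EffActionSeq P G`
with the representation (0.22) `S.Representation bg E` (`A_k(V) = −(1/g_k²)A(U_k(V)) + E_k(U_k(V))` on `bg.dom k`, `A` the
`d = 4` Wilson action `wilsonAction4`, `U_k = bg.U k`) and a characteristic function supported in `bg.dom k`, the step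
(0.19) applied to `A_k = S.A k` IS (2.1): `𝐓_k A_k = action21 T χ GF g_k (bg.U k) wilsonAction4 (E k)`.
[cite: Balaban1987RG1, (2.1) p.265] -/
theorem nextAction_eq_action21_of_representation (T : Density P k G → Density P (k+1) G) {χ : Density P k G}
    (GF : Density P k G) {S : EffActionSeq P G} {av : ∀ j, Averaging P j G} {bg : Background P G av}
    {E : (k : ℕ) → GaugeField P 0 G → ℝ} (hrep : S.Representation bg E) (hχ : ∀ V, χ V ≠ 0 → V ∈ bg.dom k) :
    nextAction T χ GF (S.flow.g k) (S.A k) = action21 T χ GF (S.flow.g k) (bg.U k) wilsonAction4 (E k) :=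
  nextAction_eq_action21 T GF (S.flow.g k) hχ fun V hV => hrep k V hV

/-- And then *«𝐄_k … is equal to (1/g_k²)A + A_k»* on `bg.dom k`, from the representation record.
[cite: Balaban1987RG1, (2.1) p.265] -/
theorem Ek_eq_of_representation {S : EffActionSeq P G} {av : ∀ j, Averaging P j G} {bg : Background P G av}
    {E : (k : ℕ) → GaugeField P 0 G → ℝ} (hrep : S.Representation bg E) {V : GaugeField P k G} (hV : V ∈ bg.dom k) :
    E k (bg.U k V) = (1 / (S.flow.g k) ^ 2) * wilsonAction4 (bg.U k V) + S.A k V :=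
  Ek_eq_of_repr (fun V hV => hrep k V hV) hV

end Eq21

end

end Literature.MathematicalPhysics.QuantumFieldTheory.Balaban1983to89.B12Eq019ActionBody
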